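import Summits.MatrixMultiplication.OmegaCensus.STPP222SqFrom24
import Summits.MatrixMultiplication.OmegaCensus.STPP222SqNoneZ12
import Summits.MatrixMultiplication.OmegaCensus.STPP222SqNoneZ13
import Summits.MatrixMultiplication.OmegaCensus.STPP222SqNoneZ14
import Summits.MatrixMultiplication.OmegaCensus.STPP222SqNoneZ15
import Summits.MatrixMultiplication.OmegaCensus.STPP222SqNoneZ16
import Summits.MatrixMultiplication.OmegaCensus.STPP222SqNoneZ17
import Summits.MatrixMultiplication.OmegaCensus.STPP222SqNoneZ18
import Summits.MatrixMultiplication.OmegaCensus.STPP222SqNoneZ19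
import Summits.MatrixMultiplication.OmegaCensus.STPP222SqNoneZ20
import Summits.MatrixMultiplication.OmegaCensus.STPP222SqNoneZ21
import Summits.MatrixMultiplication.OmegaCensus.STPP222SqNoneZ22
import Summits.MatrixMultiplication.OmegaCensus.STPP222SqNoneZ23
import Summits.MatrixMultiplication.OmegaCensus.STPP222SqNone_2_2_3
import Summits.MatrixMultiplication.OmegaCensus.STPP222SqNone_2_8
import Summits.MatrixMultiplication.OmegaCensus.STPP222SqNone_4_4
import Summits.MatrixMultiplication.OmegaCensus.STPP222SqNone_2_2_4
import Summits.MatrixMultiplication.OmegaCensus.STPP222SqNone_2_2_2_2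
import Summits.MatrixMultiplication.OmegaCensus.STPP222SqNone_2_3_3
import Summits.MatrixMultiplication.OmegaCensus.STPP222SqNone_2_2_5
import Summits.MatrixMultiplication.OmegaCensus.STPP222SqNone_5_5

/-!
# ω-census, STPP law `(2,2,2)²`: NO finite abelian group of order `≤ 23` admits it (kernel); `n₂ = 24`, `N₂ = 26` exact

HONEST FRAMING (pub-omega census; verbatim): lottery ticket; floor = certified bounds/negative ranges.
Census STRUCTURE bookkeeping (question Q7, row `k = 2` of the threshold functions `n_k`, `N_k`), not progress on `ω`:
two simultaneous `⟨2,2,2⟩` triples yield nothing of interest for matrix multiplication.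

With `STPP222SqFrom24.lean` (every finite abelian group of order `≥ 24`, `≠ 25` admits `(2,2,2)²`; so does `ℤ/25`)
this file completes the row `k = 2` IN THE KERNEL:
* `not_exists_isSTPP_222sq_of_card_le` — **no finite abelian group `G` with `Nat.card G ≤ 23` has
  `A B C : Fin 2 → Finset G`, all of cardinality `2`, with `IsSTPP A B C`;**
* `STPP222SqNeg.not_exists_isSTPP_222sq_5_5` (imported, seat pub-omega-stpp-1) — neither has `ℤ/5 × ℤ/5`;
* `exists_isSTPP_222sq_iff_card_ge` — for `Nat.card G ≠ 25`: `(2,2,2)² ⊆ G ↔ 24 ≤ |G|`.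
Hence `n₂ = 24` (least order of a group WITH the pattern) and `N₂ = 26` (every group from there on; `25` fails exactly
at `ℤ/5 × ℤ/5`), both halves kernel theorems — the `k = 2` analogue of `STPP222OneFrom8.lean` (`n₁ = 8`, `N₁ = 10`).

Proof of the negative half.  `|G| < 12`: the packing bound `card_ge_of_isSTPP_222pow` (`8k − 4 ≤ |G|`).
`12 ≤ |G| ≤ 23`: structure theorem (`AddCommGroup.equiv_directSum_zmod_of_finite`), the multiset `M` of nontrivial
prime-power factors has product `|G| ≤ 23 < 26`, hence is bounded by the capping multiset of `STPP222SqFrom24.lean`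
(`cap26_spec`), and a kernel decision (`noneList_of_capped`) matches it — up to the generic embedding
`exists_emb_of_dom`, which is onto by cardinality — with one of the twenty groups
`ℤ/12, …, ℤ/23, (ℤ/2)²×ℤ/3, ℤ/2×ℤ/8, (ℤ/4)², (ℤ/2)²×ℤ/4, (ℤ/2)⁴, ℤ/2×(ℤ/3)², (ℤ/2)²×ℤ/5, (ℤ/5)²`, each of which is
excluded by its own kernel theorem (files `STPP222SqNoneZ*.lean`, ENG2, cyclic; `STPP222SqNone_*.lean`, pub-omega-stpp-1, products:
complete searches decided by `decide +kernel`, reflected through CKSU Def. 5.1 — see `STPP222SqSearch/Reflect/Cover.lean`).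

References: H. Cohn, R. Kleinberg, B. Szegedy, C. Umans, FOCS 2005 (arXiv:math/0511460), Def. 5.1.
Record: pub-omega HOME `pub-omega-eng2/results/c4red/K2-THRESHOLD-eng2.md` §NEG (ENG2 gen 17, 2026-08-23).
-/

open Literature.Computability.AlgebraicComplexity Finset

namespace Summit.MatrixMultiplication.OmegaCensus

/-! ## 1. The twenty groups, as lists of prime-power moduli, and the combinatorial core -/

/-- The abelian groups of order `12 … 23` and `ℤ/5 × ℤ/5`, as lists of prime-power moduli (product type `SeedType`;
two-element coprime lists are the cyclic groups, read through the Chinese remainder theorem). -/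
def noneLists : List (List ℕ) :=
  [[4, 3], [2, 2, 3], [13], [2, 7], [3, 5], [16], [2, 8], [4, 4], [2, 2, 4], [2, 2, 2, 2], [17], [2, 9], [2, 3, 3],
   [19], [4, 5], [2, 2, 5], [3, 7], [2, 11], [23], [5, 5]]

/-- COMBINATORIAL CORE (kernel decision): for every modulus `1 ≤ E ≤ 23`, every sub-multiset of the capping multiset
`C_E` of `STPP222SqFrom24.lean` with product in `[12, 23]` dominates, with EQUAL product, one of the twenty lists. -/
theorem noneList_of_capped : ∀ E ∈ List.range' 1 23, ∀ M ∈ subMS (capList26 E), 12 ≤ M.prod → M.prod ≤ 23 →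
    ∃ s ∈ noneLists, dom s M = true ∧ s.prod = M.prod := by
  decide +kernel

/-- Elements of `ppList23` are at least `2`. -/
theorem two_le_of_mem_ppList23 {a : ℕ} (h : a ∈ ppList23) : 2 ≤ a := by
  simp only [ppList23, List.mem_cons, List.mem_nil_iff, or_false] at h
  omega

/-- A power of an element of a multiset of positive naturals is bounded by the product: `a ^ count a M ≤ M.prod`. -/
theorem pow_count_le_prod {M : Multiset ℕ} (hpos : ∀ x ∈ M, 1 ≤ x) (a : ℕ) : a ^ Multiset.count a M ≤ M.prod := by
  have hrep : Multiset.replicate (Multiset.count a M) a ≤ M := Multiset.le_count_iff_replicate_le.1 le_rfl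
  obtain ⟨R, hR⟩ := Multiset.le_iff_exists_add.1 hrep
  have hRpos : ∀ x ∈ R, 1 ≤ x := fun x hx => hpos x (hR ▸ Multiset.mem_add.2 (Or.inr hx))
  have h1 : 1 ≤ R.prod := Multiset.one_le_prod_of_one_le hRpos
  calc a ^ Multiset.count a M = a ^ Multiset.count a M * 1 := (mul_one _).symm
    _ ≤ a ^ Multiset.count a M * R.prod := Nat.mul_le_mul_left _ h1
    _ = (Multiset.replicate (Multiset.count a M) a + R).prod := by
        rw [Multiset.prod_add, Multiset.prod_replicate]
    _ = M.prod := by rw [← hR]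

/-- A multiset of prime powers from `ppList23`, all dividing `1 ≤ E ≤ 23`, with product `≤ 23`, is bounded by the
capping multiset `C_E` (its multiplicities are below the caps, since `a ^ count ≤ 23 < 26 ≤ a ^ cap`). -/
theorem le_capMS_of_prod_le {M : Multiset ℕ} {E : ℕ} (hEI : E ∈ List.range' 1 23) (hpp : ∀ a ∈ M, a ∈ ppList23)
    (hdvd : ∀ a ∈ M, a ∣ E) (h23 : M.prod ≤ 23) : M ≤ capMS (capList26 E) := by
  rw [Multiset.le_iff_count]
  intro a
  by_cases ha : a ∈ M
  · have h2 := two_le_of_mem_ppList23 (hpp a ha)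
    have hle : a ^ Multiset.count a M ≤ 23 :=
      le_trans (pow_count_le_prod (fun x hx => le_trans (by norm_num) (two_le_of_mem_ppList23 (hpp x hx))) a) h23
    have hcap := cap26_spec E hEI a (hpp a ha) (hdvd a ha)
    have hlt : a ^ Multiset.count a M < a ^ Multiset.count a (capMS (capList26 E)) := by omega
    exact le_of_lt ((Nat.pow_lt_pow_iff_right (by omega)).1 hlt)
  · simp [Multiset.count_eq_zero_of_notMem ha]

/-- Cardinality of a seed group: the product of its moduli. -/
theorem card_seedType : ∀ s : List ℕ, Nat.card (SeedType s) = s.prod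
  | [] => by simp [SeedType]
  | [a] => by simp [SeedType, Nat.card_zmod]
  | a :: b :: t => by
      show Nat.card (ZMod a × SeedType (b :: t)) = _
      rw [Nat.card_prod, card_seedType (b :: t), Nat.card_zmod]
      simp only [List.prod_cons]

/-! ## 2. The twenty exclusions, read on `SeedType` -/

/-- A `(2,2,2)²` configuration in `SeedType [m, n] = ℤ/m × ℤ/n` with `m, n` coprime gives one in `ℤ/(m n)` (Chinese
remainder theorem + transport along the inverse isomorphism). [cite: CohnKleinbergSzegedyUmans2005, Def. 5.1] -/
theorem exists_isSTPP_222sq_zmod_mul_of_seedPair {m n : ℕ} (h : m.Coprime n)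
    (hex : ∃ A B C : Fin 2 → Finset (SeedType [m, n]), IsSTPP A B C ∧
      ∀ i, (A i).card = 2 ∧ (B i).card = 2 ∧ (C i).card = 2) :
    ∃ A B C : Fin 2 → Finset (ZMod (m * n)), IsSTPP A B C ∧ ∀ i, (A i).card = 2 ∧ (B i).card = 2 ∧ (C i).card = 2 :=
  exists_isSTPP_222sq_of_injective (ZMod.chineseRemainder h).symm.toAddEquiv.toAddMonoidHom
    (ZMod.chineseRemainder h).symm.injective hex

/-- Each of the twenty listed groups admits no `(2,2,2)²` configuration (the twenty kernel theorems, read on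
`SeedType`; cyclic ones through `exists_isSTPP_222sq_zmod_mul_of_seedPair`). [cite: CohnKleinbergSzegedyUmans2005, Def. 5.1] -/
theorem not_exists_isSTPP_222sq_of_mem_noneLists : ∀ s ∈ noneLists, ¬ ∃ A B C : Fin 2 → Finset (SeedType s),
    IsSTPP A B C ∧ ∀ i, (A i).card = 2 ∧ (B i).card = 2 ∧ (C i).card = 2 := by
  intro s hs
  simp only [noneLists, List.mem_cons, List.mem_nil_iff, or_false] at hs
  rcases hs with rfl | rfl | rfl | rfl | rfl | rfl | rfl | rfl | rfl | rfl | rfl | rfl | rfl | rfl | rfl | rfl | rfl |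
    rfl | rfl | rfl
  · exact fun h => not_exists_isSTPP_222sq_zmod12 (exists_isSTPP_222sq_zmod_mul_of_seedPair (by norm_num) h)
  · exact STPP222SqNeg.not_exists_isSTPP_222sq_2_2_3
  · exact not_exists_isSTPP_222sq_zmod13
  · exact fun h => not_exists_isSTPP_222sq_zmod14 (exists_isSTPP_222sq_zmod_mul_of_seedPair (by norm_num) h)
  · exact fun h => not_exists_isSTPP_222sq_zmod15 (exists_isSTPP_222sq_zmod_mul_of_seedPair (by norm_num) h)
  · exact not_exists_isSTPP_222sq_zmod16
  · exact STPP222SqNeg.not_exists_isSTPP_222sq_2_8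
  · exact STPP222SqNeg.not_exists_isSTPP_222sq_4_4
  · exact STPP222SqNeg.not_exists_isSTPP_222sq_2_2_4
  · exact STPP222SqNeg.not_exists_isSTPP_222sq_2_2_2_2
  · exact not_exists_isSTPP_222sq_zmod17
  · exact fun h => not_exists_isSTPP_222sq_zmod18 (exists_isSTPP_222sq_zmod_mul_of_seedPair (by norm_num) h)
  · exact STPP222SqNeg.not_exists_isSTPP_222sq_2_3_3
  · exact not_exists_isSTPP_222sq_zmod19
  · exact fun h => not_exists_isSTPP_222sq_zmod20 (exists_isSTPP_222sq_zmod_mul_of_seedPair (by norm_num) h)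
  · exact STPP222SqNeg.not_exists_isSTPP_222sq_2_2_5
  · exact fun h => not_exists_isSTPP_222sq_zmod21 (exists_isSTPP_222sq_zmod_mul_of_seedPair (by norm_num) h)
  · exact fun h => not_exists_isSTPP_222sq_zmod22 (exists_isSTPP_222sq_zmod_mul_of_seedPair (by norm_num) h)
  · exact not_exists_isSTPP_222sq_zmod23
  · exact STPP222SqNeg.not_exists_isSTPP_222sq_5_5

/-! ## 3. Assembly -/

/-- Transfer of an exclusion along an injective additive map between finite groups of equal cardinality (then onto;
transport along the inverse). [cite: CohnKleinbergSzegedyUmans2005, Def. 5.1] -/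
theorem not_exists_isSTPP_222sq_of_card_eq {T P : Type} [AddCommGroup T] [AddCommGroup P] [Finite P] (φ : T →+ P)
    (hφ : Function.Injective φ) (hcard : Nat.card T = Nat.card P)
    (hT : ¬ ∃ A B C : Fin 2 → Finset T, IsSTPP A B C ∧ ∀ i, (A i).card = 2 ∧ (B i).card = 2 ∧ (C i).card = 2) :
    ¬ ∃ A B C : Fin 2 → Finset P, IsSTPP A B C ∧ ∀ i, (A i).card = 2 ∧ (B i).card = 2 ∧ (C i).card = 2 := by
  intro hP
  have hbij : Function.Bijective φ := hφ.bijective_of_nat_card_le (le_of_eq hcard.symm)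
  let e : T ≃+ P := AddEquiv.ofBijective φ hbij
  exact hT (exists_isSTPP_222sq_of_injective e.symm.toAddMonoidHom e.symm.injective hP)

/-- **The product case.** `Π i, ℤ/(pᵢ^{eᵢ})` (primes `pᵢ`, finitely many `i`) admits NO `(2,2,2)²` configuration when every
`pᵢ^{eᵢ}` divides some `1 ≤ E ≤ 23` and `12 ≤ ∏ pᵢ^{eᵢ} ≤ 23`. [cite: CohnKleinbergSzegedyUmans2005, Def. 5.1] -/
theorem not_exists_isSTPP_222sq_pi {ι : Type} [Fintype ι] [DecidableEq ι] (p e : ι → ℕ) (hp : ∀ i, (p i).Prime)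
    {E : ℕ} (hE1 : 1 ≤ E) (hE23 : E ≤ 23) (hdvd : ∀ i, p i ^ e i ∣ E) (h12 : 12 ≤ ∏ i, p i ^ e i)
    (h23 : ∏ i, p i ^ e i ≤ 23) :
    ¬ ∃ A B C : Fin 2 → Finset (Π i, ZMod (p i ^ e i)), IsSTPP A B C ∧
      ∀ i, (A i).card = 2 ∧ (B i).card = 2 ∧ (C i).card = 2 := by
  have hq0 : ∀ i, p i ^ e i ≠ 0 := fun i => pow_ne_zero _ (hp i).ne_zero
  haveI : ∀ i, NeZero (p i ^ e i) := fun i => ⟨hq0 i⟩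
  set M : Multiset ℕ := (Finset.univ.filter fun i => 0 < e i).val.map fun i => p i ^ e i with hM
  have hprodeq : M.prod = ∏ i, p i ^ e i := by
    rw [hM, ← Finset.prod_eq_multiset_prod]
    exact Finset.prod_filter_of_ne fun i _ hi => Nat.pos_of_ne_zero fun h0 => hi (by rw [h0, pow_zero])
  have hmem : ∀ a ∈ M, a ∈ ppList23 ∧ a ∣ E := by
    intro a ha
    obtain ⟨i, hi, rfl⟩ := Multiset.mem_map.1 ha
    have hi' : 0 < e i := (Finset.mem_filter.1 hi).2
    exact ⟨pow_mem_ppList23 (hp i) hi' (le_trans (Nat.le_of_dvd (by omega) (hdvd i)) hE23), hdvd i⟩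
  have hEI : E ∈ List.range' 1 23 := List.mem_range'_1.2 ⟨hE1, by omega⟩
  have hle : M ≤ capMS (capList26 E) :=
    le_capMS_of_prod_le hEI (fun a ha => (hmem a ha).1) (fun a ha => (hmem a ha).2) (by rw [hprodeq]; exact h23)
  obtain ⟨s, hs, hD, hsprod⟩ := noneList_of_capped E hEI M (mem_subMS_of_le _ _ hle) (by rw [hprodeq]; exact h12)
    (by rw [hprodeq]; exact h23)
  obtain ⟨φ, hφ, -⟩ := exists_emb_of_dom (fun i => p i ^ e i) hq0 s _ hD
  have hcard : Nat.card (SeedType s) = Nat.card (Π i, ZMod (p i ^ e i)) := by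
    rw [card_seedType, hsprod, hprodeq, Nat.card_pi]
    simp
  exact not_exists_isSTPP_222sq_of_card_eq φ hφ hcard (not_exists_isSTPP_222sq_of_mem_noneLists s hs)

/-- **No finite abelian group of order `≤ 23` admits two simultaneous-TPP triples of 2-subsets** (CKSU 2005 Def. 5.1,
tree form `IsSTPP`; the pattern `(2,2,2)²`) — the lower half of the census row `k = 2`: `n₂ = 24` exactly (upper
half: `STPP222SqFrom24.lean`).  Order `< 12`: packing; order `12 … 23`: structure theorem + the twenty kernel searches.
No `ω` bound follows. [cite: CohnKleinbergSzegedyUmans2005, Def. 5.1] -/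
theorem not_exists_isSTPP_222sq_of_card_le {G : Type*} [AddCommGroup G] [Finite G] (hG : Nat.card G ≤ 23) :
    ¬ ∃ A B C : Fin 2 → Finset G, IsSTPP A B C ∧ ∀ i, (A i).card = 2 ∧ (B i).card = 2 ∧ (C i).card = 2 := by
  classical
  rintro ⟨A, B, C, hS, hc⟩
  cases nonempty_fintype G
  have h12 : 12 ≤ Nat.card G := by
    have h := card_ge_of_isSTPP_222pow hS hc
    rw [Nat.card_eq_fintype_card]; omega
  obtain ⟨ι, _, p, hp, e, ⟨g⟩⟩ := AddCommGroup.equiv_directSum_zmod_of_finite G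
  let f : G ≃+ (Π i, ZMod (p i ^ e i)) :=
    g.trans (DirectSum.linearEquivFunOnFintype ℕ ι (fun i => ZMod (p i ^ e i))).toAddEquiv
  have hE1 : 1 ≤ AddMonoid.exponent G := Nat.pos_of_ne_zero AddMonoid.exponent_ne_zero_of_finite
  have hEle : AddMonoid.exponent G ≤ 23 :=
    le_trans (Nat.le_of_dvd Nat.card_pos AddGroup.exponent_dvd_nat_card) hG
  have hdvd : ∀ i, p i ^ e i ∣ AddMonoid.exponent G := fun i => by
    have hinj : Function.Injective (AddMonoidHom.single (fun j => ZMod (p j ^ e j)) i) :=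
      Pi.single_injective (M := fun j => ZMod (p j ^ e j)) i
    have h1 : addOrderOf (f.symm (AddMonoidHom.single (fun j => ZMod (p j ^ e j)) i 1)) = p i ^ e i := by
      rw [AddEquiv.addOrderOf_eq, addOrderOf_injective _ hinj, ZMod.addOrderOf_one]
    rw [← h1]
    exact AddMonoid.addOrder_dvd_exponent _
  have hcardeq : Nat.card G = ∏ i, p i ^ e i := by
    rw [Nat.card_congr f.toEquiv, Nat.card_pi]
    simp [Nat.card_zmod]
  have h := not_exists_isSTPP_222sq_pi p e hp hE1 hEle hdvd (by rw [← hcardeq]; exact h12)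
    (by rw [← hcardeq]; exact hG)
  exact h (exists_isSTPP_222sq_of_injective f.toAddMonoidHom f.injective ⟨A, B, C, hS, hc⟩)

/-- **Census row `k = 2`, both halves (kernel).**  For a finite abelian group `G` of order `≠ 25`:
`G` admits `(2,2,2)²` iff `|G| ≥ 24` (`n₂ = 24`; with `STPP222SqNeg.not_exists_isSTPP_222sq_5_5` and
`exists_isSTPP_222sq_zmod25`, `N₂ = 26`). [cite: CohnKleinbergSzegedyUmans2005, Def. 5.1] -/
theorem exists_isSTPP_222sq_iff_card_ge {G : Type*} [AddCommGroup G] [Finite G] (h25 : Nat.card G ≠ 25) :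
    (∃ A B C : Fin 2 → Finset G, IsSTPP A B C ∧ ∀ i, (A i).card = 2 ∧ (B i).card = 2 ∧ (C i).card = 2) ↔
      24 ≤ Nat.card G :=
  ⟨fun h => by by_contra hlt; exact not_exists_isSTPP_222sq_of_card_le (by omega) h,
    fun h => exists_isSTPP_222sq_of_card_ne h h25⟩

/-- **Every finite abelian group of order `≥ 26` admits `(2,2,2)²`, and `26` is sharp**: `ℤ/5 × ℤ/5` (order `25`) does
not (`N₂ = 26`, kernel both ways). [cite: CohnKleinbergSzegedyUmans2005, Def. 5.1] -/
theorem stpp222Sq_threshold_26 :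
    (∀ (G : Type) [AddCommGroup G] [Finite G], 26 ≤ Nat.card G →
      ∃ A B C : Fin 2 → Finset G, IsSTPP A B C ∧ ∀ i, (A i).card = 2 ∧ (B i).card = 2 ∧ (C i).card = 2) ∧
    ¬ ∃ A B C : Fin 2 → Finset (ZMod 5 × ZMod 5), IsSTPP A B C ∧
      ∀ i, (A i).card = 2 ∧ (B i).card = 2 ∧ (C i).card = 2 :=
  ⟨fun _ _ _ hG => exists_isSTPP_222sq_of_card hG, STPP222SqNeg.not_exists_isSTPP_222sq_5_5⟩

end Summit.MatrixMultiplication.OmegaCensus
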